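import Summits.BirchSwinnertonDyer.BirchSwinnertonDyer.Theorems.SignedBaseChangeAnticyclotomicEisensteinDivisibilitySpecializationS2NoPseudoNull
import Literature.NumberTheory.EllipticCurves.IwasawaAlgebraDivisibilityProofs
import Literature.NumberTheory.EllipticCurves.IwasawaAlgebraPromotionProofs
import HarnessLib

/-!
# Specialisation `T₁ ↦ 0` of characteristic ideals UP TO A POWER OF `p` — the rational form of stub S2
# of line `bdpline` (crux `AnticyclotomicEisensteinDivisibility`, stmt-BirchSwinnertonDyer-20727)

Helper file (`--supports stmt-BirchSwinnertonDyer-20727`) of the lead-prover seat bsd-line-sbc-p1 (gen 2),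
after the seat's `…Specialization{Length,Cyclic,Herbrand,S2,S2NoPseudoNull}` files (sbc-p1 g7). Those reduce
the specialisation step S2 of the line to the arithmetic input "`T₁` is injective on `X_Gr₂`" (⟸ no
non-zero pseudo-null submodule, Greenberg 2016 Prop. 4.1.1 — registered stub `stub_noPseudoNullSS`). With the
line's S1 now RATIONAL (skeleton v9: a power of `p` is paid by `μ(G⁻) = 0`), the PROVED full Herbrand formula
`PowerSeriesSpecialization.charIdeal_quotSMulTop_eq_mul` (`ch_A(N/XN) = ch_A(N[X]) · ch_{A⟦X⟧}(N)(0)`) lets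
S2 run with a WEAKER input: the extra factor `ch_A(N[X])` need not be trivial, only a power of `p` —
i.e. `N[X]` need only have FINITE EXPONENT (`p^m · N[X] = 0`), not vanish. This file proves:

* `Module.exists_pow_mem_charIdeal_of_pow_smul_eq_zero` — over a Noetherian factorial domain `R`, a
  finitely generated module killed by a power of a prime element `π₀` has `π₀^n ∈ ch_R(M)` for some `n`
  (from the tree's `exists_pow_mul_mem_charIdeal_of_lengthAt_le`);
* `PowerSeriesSpecialization.exists_span_pow_mul_map_charIdeal_le` — generic `A⟦X⟧ → A`: for `N` f.g.
  killed by some `s` with `s(0) ≠ 0`, if `π₀^m` kills `N[X]` then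
  `(π₀^n) · ch_{A⟦X⟧}(N)(0) ⊆ ch_A(N/XN)` for some `n`;
* `S2.map_toUnr₂_map_constantCoeff_le_rat` / `S2.xGr₂_specialization_le_rat` — the case
  `Λ₂ = ℤ_p⟦T₂⟧⟦T₁⟧ → Λ₁ = ℤ_p⟦T₂⟧` (constants `Λ₁`-structure, pinned as in the S2 file) with a surjective
  control map `X/T₁X ↠ Y` and extension of scalars along `J : ℤ_p → 𝒪_{ℂ_p}`:
  `∃ k, ∀ y ∈ π(ch_{Λ₂}(X)·Λ^ur), C(p^k)·y ∈ ch_{Λ₁}(Y)·𝒪⟦T⟧` — the membership shape of the staged child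
  `AnticyclotomicEisensteinDivisibilityRatSS` and of skeleton v10's weakened stub; and the monotonicity
  `S2.pow_smul_torsionBy_eq_zero_of_noPseudoNull` (no pseudo-null submodule ⟹ exponent `p^0`).

Pure commutative algebra over constructed modules; nothing about elliptic curves is asserted; no definitions.
-/

-- D-0017: single-problem summit, the namespace repeats the problem name by design.
set_option linter.dupNamespace false
set_option autoImplicit false

noncomputable section

open Function
open scoped Pointwise

namespace Literature.NumberTheory.EllipticCurves.Module

variable {R : Type*} [CommRing R] [IsDomain R] [IsNoetherianRing R] [UniqueFactorizationMonoid R]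
  {M : Type*} [AddCommGroup M] [_root_.Module R M]

/-- **A finitely generated module killed by a power of a prime element `π₀` has `π₀^n ∈ ch(M)`**
(over a Noetherian factorial domain): `M` is torsion, its local length vanishes at every height-one
prime not containing `π₀`, so `ch(M)` is a power of `(π₀)`. [folklore] -/
theorem exists_pow_mem_charIdeal_of_pow_smul_eq_zero [Module.Finite R M] {π₀ : R} (hπ₀ : Prime π₀)
    (hm : ∃ m : ℕ, ∀ x : M, (π₀ ^ m) • x = 0) : ∃ n : ℕ, π₀ ^ n ∈ charIdeal R M := by
  obtain ⟨m, hm⟩ := hm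
  have h0 : π₀ ^ m ≠ 0 := pow_ne_zero m hπ₀.ne_zero
  have htb : Module.IsTorsionBy R M (π₀ ^ m) := fun x => hm x
  have htors : Module.IsTorsion R M := fun x => ⟨⟨π₀ ^ m, mem_nonZeroDivisors_of_ne_zero h0⟩, hm x⟩
  obtain ⟨n, hn⟩ := exists_pow_mul_mem_charIdeal_of_lengthAt_le htors hπ₀ (G := 1) one_ne_zero
    fun 𝔭 _ h𝔭 => by
      rw [lengthAt_eq_zero_of_isTorsionBy htb 𝔭 fun h => h𝔭 (𝔭.isPrime.mem_of_pow_mem m h)]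
      exact zero_le
  exact ⟨n, by simpa using hn⟩

end Literature.NumberTheory.EllipticCurves.Module

namespace Summit.BirchSwinnertonDyer.BirchSwinnertonDyer.Theorems.SignedBaseChangeAcDivSpecialization

open Literature.NumberTheory.EllipticCurves Literature.NumberTheory.EllipticCurves.Module

namespace PowerSeriesSpecialization

open LocalLength PowerSeries

universe u v

variable {A : Type u} [CommRing A] [IsDomain A] [IsNoetherianRing A] [UniqueFactorizationMonoid A]
  [UniqueFactorizationMonoid (PowerSeries A)]

/-- **Specialisation `X ↦ 0` up to a power of a prime `π₀ ∈ A`.** Let `A` be a factorial Noetherian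
domain with `A⟦X⟧` factorial, `N` a finitely generated `A⟦X⟧`-module killed by some `s` with `s(0) ≠ 0`
(torsion, `(X) ∉ Supp N`), with a compatible `A`-structure, and suppose a power of the prime element `π₀`
kills `N[X]`. Then `(π₀^n) · ch_{A⟦X⟧}(N)(0) ⊆ ch_A(N/XN)` for some `n` — the Herbrand formula
`ch_A(N/XN) = ch_A(N[X]) · ch(N)(0)` with `π₀^n ∈ ch_A(N[X])`. [folklore] -/
theorem exists_span_pow_mul_map_charIdeal_le (N : Type v) [AddCommGroup N] [Module (PowerSeries A) N]
    [Module.Finite (PowerSeries A) N] [Module A N] [IsScalarTower A (PowerSeries A) N]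
    (hs : ∃ s : PowerSeries A, PowerSeries.constantCoeff s ≠ 0 ∧ ∀ m : N, s • m = 0)
    {π₀ : A} (hπ₀ : Prime π₀)
    (hm : ∃ m : ℕ, ∀ x : N, (X : PowerSeries A) • x = 0 → (π₀ ^ m) • x = 0) :
    ∃ n : ℕ, Ideal.span {π₀ ^ n} * (charIdeal (PowerSeries A) N).map (PowerSeries.constantCoeff (R := A)) ≤
      charIdeal A (QuotSMulTop (X : PowerSeries A) N) := by
  haveI : Module.Finite A (Submodule.torsionBy (PowerSeries A) N (X : PowerSeries A)) :=
    moduleFinite_torsionBy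
  obtain ⟨m, hm⟩ := hm
  have hm' : ∃ m : ℕ, ∀ x : Submodule.torsionBy (PowerSeries A) N (X : PowerSeries A), (π₀ ^ m) • x = 0 :=
    ⟨m, fun x => Subtype.ext (by
      rw [Submodule.coe_smul_of_tower, Submodule.coe_zero]
      exact hm x ((Submodule.mem_torsionBy_iff _ _).mp x.2))⟩
  obtain ⟨n, hn⟩ := exists_pow_mem_charIdeal_of_pow_smul_eq_zero
    (M := Submodule.torsionBy (PowerSeries A) N (X : PowerSeries A)) hπ₀ hm'
  refine ⟨n, ?_⟩
  rw [charIdeal_quotSMulTop_eq_mul N hs]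
  exact Ideal.mul_mono_left ((Ideal.span_singleton_le_iff_mem _).mpr hn)

end PowerSeriesSpecialization

namespace S2

open LocalLength PowerSeriesSpecialization

/-- **Rational specialisation for `Λ₂ = ℤ_p⟦T₂⟧⟦T₁⟧ → Λ₁ = ℤ_p⟦T₂⟧`-modules with control.** Let `X` be a
finitely generated `Λ₂`-module killed by some `s` with `s(0) ≠ 0`, suppose `p^m` kills `X[T₁]` for some
`m`, and let `f : X/T₁X ↠ Y` be a surjective `Λ₁`-linear map (constants `Λ₁`-structure on `X/T₁X`). Then for
every structure map `J : ℤ_p → 𝒪 = 𝒪_{ℂ_p}` there is `k` with `C(p^k)·y ∈ ch_{Λ₁}(Y)·𝒪⟦T⟧` for every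
`y ∈ π(ch_{Λ₂}(X)·Λ^ur)`: `(p^k)·π(ch_{Λ₂}X) ⊆ ch(X[T₁])·π(ch_{Λ₂}X) = ch(X/T₁X) = ch(ker f)·ch(Y) ⊆ ch(Y)`,
then extend scalars. The case `m = 0` (`T₁` injective) is `map_toUnr₂_map_constantCoeff_le` with `k = 0`.
[folklore] -/
theorem map_toUnr₂_map_constantCoeff_le_rat (p : ℕ) [Fact p.Prime] (X : Type*) [AddCommGroup X]
    [Module (PowerSeries (IwasawaAlgebra p)) X] [Module.Finite (PowerSeries (IwasawaAlgebra p)) X]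
    (Y : Type*) [AddCommGroup Y] [Module (IwasawaAlgebra p) Y]
    (hs : ∃ s : PowerSeries (IwasawaAlgebra p),
      PowerSeries.constantCoeff s ≠ 0 ∧ ∀ x : X, s • x = 0)
    (hm : ∃ m : ℕ, ∀ x : X, (PowerSeries.X : PowerSeries (IwasawaAlgebra p)) • x = 0 →
      ((p : PowerSeries (IwasawaAlgebra p)) ^ m) • x = 0)
    (f : letI : Module (IwasawaAlgebra p)
              (QuotSMulTop (PowerSeries.X : PowerSeries (IwasawaAlgebra p)) X) :=
            Module.compHom _ (PowerSeries.C (R := IwasawaAlgebra p))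
      QuotSMulTop (PowerSeries.X : PowerSeries (IwasawaAlgebra p)) X →ₗ[IwasawaAlgebra p] Y)
    (hf : Surjective f) (J : ℤ_[p] →+* PadicComplexInt p) :
    ∃ k : ℕ, ∀ y ∈ ((charIdeal (PowerSeries (IwasawaAlgebra p)) X).map (IwasawaAlgebra₂.toUnr₂ p J)).map
        (PowerSeries.constantCoeff (R := PowerSeries (PadicComplexInt p))),
      PowerSeries.C (((p : ℕ) : PadicComplexInt p) ^ k) * y ∈
        (charIdeal (IwasawaAlgebra p) Y).map (PowerSeries.map J) := by
  haveI : UniqueFactorizationMonoid (PowerSeries (IwasawaAlgebra p)) :=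
    Literature.NumberTheory.IwasawaTheory.uniqueFactorizationMonoid_iwasawaAlgebraTwoVar p
  -- the constants algebra `C : Λ₁ → Λ₂` (NOT Mathlib's default `algebraPowerSeries`, `T ↦ T₁`)
  let alg : Algebra (IwasawaAlgebra p) (PowerSeries (IwasawaAlgebra p)) :=
    @MvPowerSeries.instAlgebra Unit (IwasawaAlgebra p) (IwasawaAlgebra p) _ _ (Algebra.id _)
  letI : Module (IwasawaAlgebra p) X := Module.compHom X (PowerSeries.C (R := IwasawaAlgebra p))
  have hIST : @IsScalarTower (IwasawaAlgebra p) (PowerSeries (IwasawaAlgebra p)) X alg.toSMul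
      inferInstance inferInstance :=
    @IsScalarTower.mk _ _ _ alg.toSMul _ _ fun a r m => by
      rw [@Algebra.smul_def _ _ _ _ alg a r, mul_smul]
      rfl
  -- the hypothesis on `X[T₁]` in `Λ₁`-form: `(p : Λ₁)^m • x = C(p^m) • x = (p : Λ₂)^m • x`
  have hm' : ∃ m : ℕ, ∀ x : X, (PowerSeries.X : PowerSeries (IwasawaAlgebra p)) • x = 0 →
      ((p : IwasawaAlgebra p) ^ m) • x = 0 := by
    obtain ⟨m, hm⟩ := hm
    refine ⟨m, fun x hx => ?_⟩
    show (PowerSeries.C (R := IwasawaAlgebra p) ((p : IwasawaAlgebra p) ^ m)) • x = 0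
    rw [map_pow, map_natCast]
    exact hm x hx
  -- Λ₁-level: `(p^n) · π(ch X) ⊆ ch(X/T₁X) = ch(ker f) · ch(Y) ⊆ ch(Y)`
  obtain ⟨n, hn⟩ := @exists_span_pow_mul_map_charIdeal_le (IwasawaAlgebra p) _ _ _ _ _ X _ _ _ _ hIST hs
    _ IwasawaAlgebra.prime_natCast hm'
  obtain ⟨s, hs0, hs⟩ := hs
  haveI : Module.Finite (IwasawaAlgebra p)
      (QuotSMulTop (PowerSeries.X : PowerSeries (IwasawaAlgebra p)) X) :=
    @moduleFinite_quotSMulTop (IwasawaAlgebra p) _ X _ _ _ hIST _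
  have h1 := (@isTorsionBy_constantCoeff (IwasawaAlgebra p) _ X _ _ _ hIST s hs).1
  have htors : Module.IsTorsion (IwasawaAlgebra p)
      (QuotSMulTop (PowerSeries.X : PowerSeries (IwasawaAlgebra p)) X) := fun q =>
    ⟨⟨PowerSeries.constantCoeff s, mem_nonZeroDivisors_of_ne_zero hs0⟩, @h1 q⟩
  have hY : Ideal.span {(p : IwasawaAlgebra p) ^ n} *
      (charIdeal (PowerSeries (IwasawaAlgebra p)) X).map (PowerSeries.constantCoeff (R := IwasawaAlgebra p)) ≤
      charIdeal (IwasawaAlgebra p) Y := by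
    refine hn.trans ?_
    rw [charIdeal_eq_mul_of_exact htors (LinearMap.ker f).subtype f (Submodule.subtype_injective _) hf
      (LinearMap.exact_subtype_ker_map f)]
    exact Ideal.mul_le_left
  -- extend scalars along `J` and read membership-wise
  refine ⟨n, fun y hy => ?_⟩
  rw [Ideal.map_map, constantCoeff_comp_toUnr₂, ← Ideal.map_map] at hy
  have hY' := Ideal.map_mono (f := PowerSeries.map J) hY
  rw [Ideal.map_mul, Ideal.map_span, Set.image_singleton, map_pow, map_natCast] at hY'
  refine hY' (Ideal.mul_mem_mul ?_ hy)
  rw [map_pow, map_natCast]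
  exact Ideal.mem_span_singleton_self _

/-- **Monotonicity: no non-zero pseudo-null submodule ⟹ finite exponent (`m = 0`).** If the finitely generated
`Λ₂`-module `X` dies at the height-one prime `(T₁)` and has no non-zero pseudo-null submodule, then `X[T₁] = 0`,
so in particular `p^0` kills `X[T₁]` — the registered stub `stub_noPseudoNullSS` of skeleton v4–v9 implies the
weaker finite-exponent input of v10. [folklore] -/
theorem pow_smul_torsionBy_eq_zero_of_noPseudoNull (p : ℕ) [Fact p.Prime] (X : Type*) [AddCommGroup X]
    [Module (PowerSeries (IwasawaAlgebra p)) X]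
    (h0 : lengthAt (PowerSeries (IwasawaAlgebra p)) X
      ⟨Ideal.span {(PowerSeries.X : PowerSeries (IwasawaAlgebra p))}, PowerSeries.span_X_isPrime⟩ = 0)
    (hPN : ∀ N : Submodule (PowerSeries (IwasawaAlgebra p)) X,
      IsPseudoNull (PowerSeries (IwasawaAlgebra p)) N → N = ⊥) :
    ∃ m : ℕ, ∀ x : X, (PowerSeries.X : PowerSeries (IwasawaAlgebra p)) • x = 0 →
      ((p : PowerSeries (IwasawaAlgebra p)) ^ m) • x = 0 := by
  have hXp : Prime (PowerSeries.X : PowerSeries (IwasawaAlgebra p)) := PowerSeries.X_prime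
  refine ⟨0, fun x hx => ?_⟩
  rw [torsionBy_eq_bot_of_noPseudoNull hXp h0 hPN x hx, smul_zero]

/-- **Rational stub S2 of line `bdpline` for the constructed carriers** `X_Gr₂ = X_Gr(E/K̃_∞)`
(`WeierstrassCurve.XGr₂`) and `X_ac = X_Gr(E/K_∞⁻)` (`Castella2018.AcSelmer.XAc … ∅ γ₂`): finite generation +
a killing element `s` with `s(0) ≠ 0`, FINITE EXPONENT of `X_Gr₂[T₁]` and a surjective `Λ₁`-linear control map
`X_Gr₂/T₁ ↠ X_ac` give `∃ k, p^k·π(ch(X_Gr₂)·Λ^ur) ⊆ ch(X_ac)·𝒪⟦T⟧` (membership form) — the shape consumed by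
skeleton v10 (stubs `stub_torsionSS`, `stub_finiteExponentSS`, and the PROVED `stub_controlSurjSS`). [folklore] -/
theorem xGr₂_specialization_le_rat {K : Type} [Field K] [NumberField K] (W : WeierstrassCurve K)
    (p : ℕ) [Fact p.Prime] (κ₁ κ₂ : ZpExtension K p)
    (vbar : IsDedekindDomain.HeightOneSpectrum (NumberField.RingOfIntegers K))
    (γ₁ γ₂ : Field.absoluteGaloisGroup K) [Fact (ZpExtension.IsTopGeneratorPair κ₁ κ₂ γ₁ γ₂)]
    [Fact (κ₂.IsTopGenerator γ₂)]
    [Module.Finite (IwasawaAlgebra₂ p) (W.XGr₂ p κ₁ κ₂ vbar γ₁ γ₂)]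
    (hs : ∃ s : IwasawaAlgebra₂ p,
      PowerSeries.constantCoeff s ≠ 0 ∧ ∀ x : W.XGr₂ p κ₁ κ₂ vbar γ₁ γ₂, s • x = 0)
    (hm : ∃ m : ℕ, ∀ x : W.XGr₂ p κ₁ κ₂ vbar γ₁ γ₂, (PowerSeries.X : IwasawaAlgebra₂ p) • x = 0 →
      ((p : IwasawaAlgebra₂ p) ^ m) • x = 0)
    (f : letI : Module (IwasawaAlgebra p)
              (QuotSMulTop (PowerSeries.X : IwasawaAlgebra₂ p) (W.XGr₂ p κ₁ κ₂ vbar γ₁ γ₂)) :=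
            Module.compHom _ (PowerSeries.C (R := IwasawaAlgebra p))
      QuotSMulTop (PowerSeries.X : IwasawaAlgebra₂ p) (W.XGr₂ p κ₁ κ₂ vbar γ₁ γ₂) →ₗ[IwasawaAlgebra p]
        Castella2018.AcSelmer.XAc W p κ₂ vbar ∅ γ₂)
    (hf : Surjective f) (J : ℤ_[p] →+* PadicComplexInt p) :
    ∃ k : ℕ, ∀ y ∈ ((WeierstrassCurve.XGr₂.charIdeal W p κ₁ κ₂ vbar γ₁ γ₂).map (IwasawaAlgebra₂.toUnr₂ p J)).map
        (PowerSeries.constantCoeff (R := PowerSeries (PadicComplexInt p))),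
      PowerSeries.C (((p : ℕ) : PadicComplexInt p) ^ k) * y ∈
        (Castella2018.AcSelmer.XAc.charIdeal W p κ₂ vbar ∅ γ₂).map (PowerSeries.map J) :=
  map_toUnr₂_map_constantCoeff_le_rat p (W.XGr₂ p κ₁ κ₂ vbar γ₁ γ₂) (Castella2018.AcSelmer.XAc W p κ₂ vbar ∅ γ₂)
    hs hm f hf J

end S2

end Summit.BirchSwinnertonDyer.BirchSwinnertonDyer.Theorems.SignedBaseChangeAcDivSpecialization

end
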